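import Mathlib

/-!
# Tail bound for majorant-dominated Frobenius recursions (K21)

Solo seat `solo-NavierStokesRegularity-informed`, session 13; companion of
`paper/swirling-cone-linearisation.md` §5b (Lemma 11.4, the certified version Q6′ of Evidence 11.1).
If the weighted coefficient norms `v j = ‖U_j‖ r^j` of a formal Frobenius solution satisfy, from some
index `N` on, the majorant recursion `v j ≤ c * Σ_{l<j} v l` (this is what the Neumann bound
`‖(λ+j-H₀)⁻¹‖ ≤ 1/(λ+j-η)` and a Cauchy majorant `‖H_i‖ ≤ M r^{-i}` give, with `c = M/(λ+N-η)`),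
then the partial sums grow at most geometrically with ratio `1 + c`
(`majorant_partialSum_le`), each later term is dominated by a geometric sequence
(`majorant_term_le`), and for `(1 + c) θ < 1` the tail `Σ_{i} v (N+i) θ^(N+i)` is summable and
bounded by `c * (Σ_{l<N} v l) * θ^N / (1 - (1+c) θ)` (`majorant_tail_le`). This is exactly the
inequality applied by the exact-rational certificates (`work/cone/linm/cert/cert.py`); here it is
kernel-checked. No new definitions; axioms: standard.
-/

namespace Summit.NavierStokesRegularity.NavierStokesRegularity.Theorems

open Finset

/-- Partial sums of a sequence obeying `v j ≤ c * Σ_{l<j} v l` for `j ≥ N` (with `0 ≤ c`) grow at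
most like `(1 + c)^i` beyond `N`. -/
theorem majorant_partialSum_le (v : ℕ → ℝ) {c : ℝ} (hc : 0 ≤ c) (N : ℕ)
    (hrec : ∀ j, N ≤ j → v j ≤ c * ∑ l ∈ range j, v l) (i : ℕ) :
    ∑ l ∈ range (N + i), v l ≤ (1 + c) ^ i * ∑ l ∈ range N, v l := by
  induction i with
  | zero => simp
  | succ i ih =>
    have hj : v (N + i) ≤ c * ∑ l ∈ range (N + i), v l := hrec (N + i) (Nat.le_add_right N i)
    have hstep : ∑ l ∈ range (N + (i + 1)), v l ≤ (1 + c) * ∑ l ∈ range (N + i), v l := by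
      rw [← Nat.add_assoc, sum_range_succ]
      linarith
    have h1c : 0 ≤ 1 + c := by linarith
    calc ∑ l ∈ range (N + (i + 1)), v l
        ≤ (1 + c) * ∑ l ∈ range (N + i), v l := hstep
      _ ≤ (1 + c) * ((1 + c) ^ i * ∑ l ∈ range N, v l) := mul_le_mul_of_nonneg_left ih h1c
      _ = (1 + c) ^ (i + 1) * ∑ l ∈ range N, v l := by ring

/-- Each term beyond `N` is dominated by a geometric sequence with ratio `(1 + c) θ`. -/
theorem majorant_term_le (v : ℕ → ℝ) {c θ : ℝ} (hc : 0 ≤ c) (hθ : 0 ≤ θ) (N : ℕ)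
    (hrec : ∀ j, N ≤ j → v j ≤ c * ∑ l ∈ range j, v l) (i : ℕ) :
    v (N + i) * θ ^ (N + i) ≤ (c * (∑ l ∈ range N, v l) * θ ^ N) * ((1 + c) * θ) ^ i := by
  have hj : v (N + i) ≤ c * ∑ l ∈ range (N + i), v l := hrec (N + i) (Nat.le_add_right N i)
  have hS := majorant_partialSum_le v hc N hrec i
  have hv : v (N + i) ≤ c * ((1 + c) ^ i * ∑ l ∈ range N, v l) :=
    hj.trans (mul_le_mul_of_nonneg_left hS hc)
  have hθpow : 0 ≤ θ ^ (N + i) := pow_nonneg hθ _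
  calc v (N + i) * θ ^ (N + i)
      ≤ c * ((1 + c) ^ i * ∑ l ∈ range N, v l) * θ ^ (N + i) :=
        mul_le_mul_of_nonneg_right hv hθpow
    _ = (c * (∑ l ∈ range N, v l) * θ ^ N) * ((1 + c) * θ) ^ i := by
        rw [pow_add, mul_pow]; ring

/-- LEMMA 11.4 (tail bound). With `0 ≤ v`, `0 ≤ c`, `0 ≤ θ`, `(1 + c) θ < 1` and the majorant
recursion from `N` on, the tail series is summable and
`Σ' i, v (N+i) θ^(N+i) ≤ c (Σ_{l<N} v l) θ^N / (1 - (1+c) θ)`. -/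
theorem majorant_tail_le (v : ℕ → ℝ) (hv : ∀ j, 0 ≤ v j) {c θ : ℝ} (hc : 0 ≤ c) (hθ : 0 ≤ θ)
    (hρ : (1 + c) * θ < 1) (N : ℕ) (hrec : ∀ j, N ≤ j → v j ≤ c * ∑ l ∈ range j, v l) :
    Summable (fun i => v (N + i) * θ ^ (N + i)) ∧
      ∑' i, v (N + i) * θ ^ (N + i) ≤ c * (∑ l ∈ range N, v l) * θ ^ N / (1 - (1 + c) * θ) := by
  set ρ := (1 + c) * θ with hρdef
  set K := c * (∑ l ∈ range N, v l) * θ ^ N with hKdef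
  have hρ0 : 0 ≤ ρ := mul_nonneg (by linarith) hθ
  have hgeom : Summable (fun i : ℕ => ρ ^ i) := summable_geometric_of_lt_one hρ0 hρ
  have hg : Summable (fun i : ℕ => K * ρ ^ i) := hgeom.mul_left K
  have hle : ∀ i, v (N + i) * θ ^ (N + i) ≤ K * ρ ^ i :=
    fun i => majorant_term_le v hc hθ N hrec i
  have hnn : ∀ i, 0 ≤ v (N + i) * θ ^ (N + i) := fun i => mul_nonneg (hv _) (pow_nonneg hθ _)
  have hf : Summable (fun i => v (N + i) * θ ^ (N + i)) := Summable.of_nonneg_of_le hnn hle hg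
  refine ⟨hf, ?_⟩
  calc ∑' i, v (N + i) * θ ^ (N + i)
      ≤ ∑' i, K * ρ ^ i := hf.tsum_le_tsum hle hg
    _ = K * ∑' i, ρ ^ i := tsum_mul_left
    _ = K * (1 - ρ)⁻¹ := by rw [tsum_geometric_of_lt_one hρ0 hρ]
    _ = K / (1 - ρ) := by rw [div_eq_mul_inv]

end Summit.NavierStokesRegularity.NavierStokesRegularity.Theorems
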